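import Literature.Geometry.Kaehler.ComplexTorusLineBundleFactor
import Literature.Analysis.Complex.SeveralVariables
import HarnessLib

/-!
# First-order calculus of frames and factors of automorphy on a complex torus:
# a periodic first-order coboundary for the transition functions descends to the factor

Layer `Literature/Geometry/Kaehler`, namespace `Literature.Geometry.Kaehler.ComplexTorus`.  THEOREMS ONLY (no
definition, no named fact, no instance).  Setting of `ComplexTorusLineBundleFactor`: `X = V/Λ` a complex torus
(`ComplexTorus Φ`, `π = cover Φ : V → X`), `L` a holomorphic line bundle on `X` in the tree's cocycle presentation
(`HolomorphicLineBundle κ E X`, charts `U_k = L.baseSet k`, transition functions `g_{kl} = L.coordChange k l`), and a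
frame `s = (s_k)` of `π^*L` over the `π⁻¹U_k` (`IsCoverFrame L s`) with its factor of automorphy
`e = factorOfFrame L s` (`e(λ, z) = s_k(z)/s_k(z + λ)`; Lange, Prop. 1.2.2: «the line bundle `L = V × ℂ/Λ` given by
the factor `f`», Prop. 1.2.3: «choosing another trivialization exactly means […] an equivalent factor»).

For a vector `w ∈ V` we record the LOGARITHMIC `w`-DERIVATIVES of these identities (the first-order effect of the
translation `t_{εw}`, `ε² = 0`, on the cocycle of `L` — Mumford, *Abelian Varieties* §13, proof of the theorem on
p. 125, computes the tangent map of `x ↦ t_x^*L ⊗ L⁻¹` this way):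

* §1 private calculus helpers (`f = g·h` near `z` ⇒ `∂_w f/f = ∂_w g/g + ∂_w h/h`; derivative of a translate);
* §2 `IsCoverFrame.fderiv_div_frame_eq` (`∂_w s_l/s_l = ∂_w(g_{kl}∘π)/(g_{kl}∘π) + ∂_w s_k/s_k` on `π⁻¹(U_k ∩ U_l)`),
  `IsCoverFrame.fderiv_div_factorOfFrame_eq` (`∂_w e(λ,·)/e(λ,·) = ∂_w s_k/s_k − (∂_w s_k/s_k)(· + λ)`), and the
  MAIN LEMMA **`IsCoverFrame.exists_fderiv_div_factorOfFrame_eq_sub`**: if the logarithmic `w`-derivatives of the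
  transition functions are coboundaries of `Λ`-PERIODIC holomorphic functions `H_k` on the cover pieces
  (`∂_w(g_{kl}∘π)/(g_{kl}∘π) = H_l − H_k` on `π⁻¹(U_k ∩ U_l)` — e.g. the analytification of an algebraic
  trivialisation of the first-order deformation `t_{εw}^*L ⊗ L⁻¹`), then `F := ∂_w s_k/s_k − H_k` is independent
  of `k`, ENTIRE (Osgood: `∂_w` of a holomorphic function is holomorphic, the tree's
  `SCV.differentiableOn_fderiv_apply`), and `∂_w e(λ,·)/e(λ,·) = F − F(· + λ)` for every `λ ∈ Λ`: the first-order
  variation of the factor along `w` is a coboundary in `Z¹(Λ, H⁰(𝒪_V))`.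

Consumer: `ComplexTorusFirstOrderRigidity` (with a POSITIVE class this forces `w = 0`).  Presearch: [corpus:
book:lange1992-complex-abelian-varieties chunks p0030 (Prop. 1.2.2/1.2.3), p0049 (Thm. 1.4.15)] give the factor
dictionary and `dφ_L = H`; the frame-level first-order bookkeeping is not printed as a statement (folklore step of
Mumford §13 / Kodaira–Spencer for tori); galaxy «factor of automorphy|first order deformation|Kodaira-Spencer»: no
usable hit.  Mathlib searched and used: `Filter.EventuallyEq.fderiv_eq`, `fderiv_fun_mul`, `fderiv_comp_add_right`,
`HasDerivAt.comp_hasDerivAt`, `DifferentiableOn.differentiableAt`,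
`mdifferentiableOn_iff_differentiableOn`, `DifferentiableAt.congr_of_eventuallyEq`.

## References
* H. Lange, *Abelian Varieties over the Complex Numbers*, Grundlehren Text Edition (2023): §1.2.1 Lemma 1.2.1,
  Prop. 1.2.2–1.2.3 (pp. 21–22). [Lange2023AbelianVarietiesComplex]
* D. Mumford, *Abelian Varieties* (1970), §13, proof of the Theorem (p. 125). [MumfordAV1970]
* C. Voisin, *Hodge Theory and Complex Algebraic Geometry I* (2002), §3.3.1 (holomorphic transition functions). [VoisinHodgeI2002]
* L. Hörmander, *An Introduction to Complex Analysis in Several Variables* (1973), Thm. 2.2.1 (Osgood). [HormanderSCV1973]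
-/

noncomputable section

open scoped Topology Manifold
open Set Filter Function Complex

namespace Literature.Geometry.Kaehler

namespace ComplexTorus

/-! ## §1 Calculus helpers (private) -/

section Calculus

variable {E : Type*} [NormedAddCommGroup E] [NormedSpace ℂ E]

/-- Logarithmic derivative of a local product identity `f = g · h` near `z`:
`∂_v f / f = ∂_v g / g + ∂_v h / h` at `z`. [folklore] -/
private theorem fderiv_apply_div_eq_add_of_eventuallyEq_mul {f g h : E → ℂ} {z : E} (hfg : f =ᶠ[𝓝 z] fun y ↦ g y * h y)
    (hg : DifferentiableAt ℂ g z) (hh : DifferentiableAt ℂ h z) (hg0 : g z ≠ 0) (hh0 : h z ≠ 0) (v : E) :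
    fderiv ℂ f z v / f z = fderiv ℂ g z v / g z + fderiv ℂ h z v / h z := by
  have hf : f z = g z * h z := hfg.eq_of_nhds
  rw [hfg.fderiv_eq, fderiv_fun_mul hg hh, hf]
  rw [_root_.add_apply, _root_.smul_apply, _root_.smul_apply, smul_eq_mul, smul_eq_mul]
  field_simp
  ring

/-- The derivative of a translate: `∂_v (f(· + c))(z) = ∂_v f (z + c)`. [folklore] -/
private theorem fderiv_comp_add_right_apply (f : E → ℂ) (c z v : E) :
    fderiv ℂ (fun y ↦ f (y + c)) z v = fderiv ℂ f (z + c) v := by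
  rw [fderiv_comp_add_right]

end Calculus

/-! ## §2 The frame bookkeeping: a first-order coboundary on the cover descends to a coboundary for the factor -/

section Frame

variable {ι κ : Type*} [Fintype ι] {E : Type*} [NormedAddCommGroup E] [NormedSpace ℂ E]
  {Φ : (ι → ℝ) ≃L[ℝ] E} {L : HolomorphicLineBundle κ E (ComplexTorus Φ)} {s : κ → E → ℂ}

/-- The frame functions are complex-differentiable at every point over their trivialising set. [cite: Lange2023AbelianVarietiesComplex, §1.2.1 Prop. 1.2.3 (p. 22)] -/
theorem IsCoverFrame.differentiableAt (hs : IsCoverFrame L s) {k : κ} {z : E} (hk : cover Φ z ∈ L.baseSet k) :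
    DifferentiableAt ℂ (s k) z :=
  (hs.differentiableOn k).differentiableAt
    (((L.isOpen_baseSet k).preimage (continuous_cover Φ)).mem_nhds hk)

/-- The transition functions read on the universal cover are complex-differentiable over the overlaps.
[cite: VoisinHodgeI2002, §3.3.1] -/
theorem differentiableAt_coordChange_comp_cover (L : HolomorphicLineBundle κ E (ComplexTorus Φ)) {k l : κ} {z : E}
    (hk : cover Φ z ∈ L.baseSet k) (hl : cover Φ z ∈ L.baseSet l) :
    DifferentiableAt ℂ (fun y ↦ L.coordChange k l (cover Φ y)) z := by
  have hO : IsOpen (cover Φ ⁻¹' (L.baseSet k ∩ L.baseSet l)) :=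
    ((L.isOpen_baseSet k).inter (L.isOpen_baseSet l)).preimage (continuous_cover Φ)
  have hmd : MDifferentiableOn 𝓘(ℂ, E) 𝓘(ℂ, ℂ) (fun y ↦ L.coordChange k l (cover Φ y))
      (cover Φ ⁻¹' (L.baseSet k ∩ L.baseSet l)) := fun y hy ↦
    ((L.mdifferentiableOn_coordChange k l) (cover Φ y) hy).comp y
      (mdifferentiable_cover Φ (𝕜 := ℂ) y).mdifferentiableWithinAt (fun _ h ↦ h)
  have hd : DifferentiableOn ℂ (fun y ↦ L.coordChange k l (cover Φ y)) (cover Φ ⁻¹' (L.baseSet k ∩ L.baseSet l)) :=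
    mdifferentiableOn_iff_differentiableOn.1 hmd
  exact hd.differentiableAt (hO.mem_nhds ⟨hk, hl⟩)

/-- **Log-derivative of the frame change**: on `π⁻¹(U_k ∩ U_l)`,
`∂_v s_l / s_l = ∂_v (g_{kl} ∘ π) / (g_{kl} ∘ π) + ∂_v s_k / s_k` (from `s_l = (g_{kl} ∘ π) s_k`).
[cite: Lange2023AbelianVarietiesComplex, §1.2.1 Prop. 1.2.3 (p. 22)] -/
theorem IsCoverFrame.fderiv_div_frame_eq (hs : IsCoverFrame L s) {k l : κ} {z : E}
    (hk : cover Φ z ∈ L.baseSet k) (hl : cover Φ z ∈ L.baseSet l) (v : E) :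
    fderiv ℂ (s l) z v / s l z =
      fderiv ℂ (fun y ↦ L.coordChange k l (cover Φ y)) z v / L.coordChange k l (cover Φ z) +
        fderiv ℂ (s k) z v / s k z := by
  have hO : IsOpen (cover Φ ⁻¹' (L.baseSet k ∩ L.baseSet l)) :=
    ((L.isOpen_baseSet k).inter (L.isOpen_baseSet l)).preimage (continuous_cover Φ)
  have hev : s l =ᶠ[𝓝 z] fun y ↦ L.coordChange k l (cover Φ y) * s k y :=
    Filter.eventually_of_mem (hO.mem_nhds ⟨hk, hl⟩) fun y hy ↦ hs.eq_mul k l y hy.1 hy.2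
  exact fderiv_apply_div_eq_add_of_eventuallyEq_mul hev (differentiableAt_coordChange_comp_cover L hk hl)
    (hs.differentiableAt hk) (L.coordChange_ne_zero k l _ ⟨hk, hl⟩) (hs.ne_zero k z hk) v

/-- **Log-derivative of the factor of a frame**: for `π z ∈ U_k`,
`∂_v e(λ, ·) / e(λ, ·) = ∂_v s_k / s_k − (∂_v s_k / s_k)(· + λ)` at `z` (from `e(λ, y) s_k(y + λ) = s_k(y)` near `z`).
[cite: Lange2023AbelianVarietiesComplex, §1.2.1 Prop. 1.2.2 and (1.8) (p. 21)] -/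
theorem IsCoverFrame.fderiv_div_factorOfFrame_eq (hs : IsCoverFrame L s) {k : κ} {z : E}
    (hk : cover Φ z ∈ L.baseSet k) (n : ι → ℤ) (v : E) :
    fderiv ℂ (factorOfFrame L s n) z v / factorOfFrame L s n z =
      fderiv ℂ (s k) z v / s k z -
        fderiv ℂ (s k) (z + latticeVec Φ n) v / s k (z + latticeVec Φ n) := by
  have hO : IsOpen (cover Φ ⁻¹' L.baseSet k) := (L.isOpen_baseSet k).preimage (continuous_cover Φ)
  have hk' : cover Φ (z + latticeVec Φ n) ∈ L.baseSet k := by rwa [cover_add_latticeVec]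
  -- `s_k = e(λ, ·) * s_k(· + λ)` near `z`
  have hev : s k =ᶠ[𝓝 z] fun y ↦ factorOfFrame L s n y * s k (y + latticeVec Φ n) := by
    refine Filter.eventually_of_mem (hO.mem_nhds hk) fun y hy ↦ ?_
    have hy' : cover Φ (y + latticeVec Φ n) ∈ L.baseSet k := by rw [cover_add_latticeVec]; exact hy
    show s k y = factorOfFrame L s n y * s k (y + latticeVec Φ n)
    rw [hs.factorOfFrame_eq hy n, div_mul_cancel₀ _ (hs.ne_zero k _ hy')]
  have hshift : DifferentiableAt ℂ (fun y ↦ s k (y + latticeVec Φ n)) z :=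
    (hs.differentiableAt hk').comp z (differentiableAt_id.add_const _)
  have h := fderiv_apply_div_eq_add_of_eventuallyEq_mul hev ((hs.isFactor.differentiable n) z) hshift
    (hs.isFactor.ne_zero n z) (hs.ne_zero k _ hk') v
  rw [fderiv_comp_add_right_apply] at h
  linear_combination (-1 : ℂ) * h

/-- **FRAME BOOKKEEPING ON A REFINEMENT: a PERIODIC first-order coboundary for the transition functions, given on
an open refinement `(V_a ⊆ U_{k(a)})_a` of the trivialising cover, descends to a first-order coboundary for the factor of
automorphy.**  Let `L` be any holomorphic line bundle on `X = V/Λ` with a frame `s` of `π^*L` (factor `e`), `w ∈ V`,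
`(V_a)_a` an open cover of `X` with a chart assignment `V_a ⊆ U_{k(a)}`, and suppose the logarithmic `w`-derivatives of
the transition functions `g_{k(a)k(b)}` are coboundaries of Λ-PERIODIC holomorphic functions `H_a` on the pieces
`π⁻¹V_a` (`∂_w(g_{k(a)k(b)} ∘ π)/(g_{k(a)k(b)} ∘ π) = H_b − H_a` on `π⁻¹(V_a ∩ V_b)` — e.g. the analytification of an
ALGEBRAIC trivialisation, on an affine refinement, of the first-order deformation `t_{εw}^*L ⊗ L⁻¹`).  Then
`F := ∂_w s_{k(a)}/s_{k(a)} − H_a` is independent of `a`, entire, and `∂_w e(λ, ·)/e(λ, ·) = F − F(· + λ)`: the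
first-order variation of the factor along `w` is a coboundary in `Z¹(Λ, H⁰(𝒪_V))`.
[cite: Lange2023AbelianVarietiesComplex, §1.2.1 Prop. 1.2.3 (p. 22)] [cite: MumfordAV1970, §13 (p. 125)] -/
theorem IsCoverFrame.exists_fderiv_div_factorOfFrame_eq_sub_of_refinement (hs : IsCoverFrame L s) (w : E)
    {α : Type*} {V : α → Set (ComplexTorus Φ)} {k : α → κ} (hVU : ∀ a, V a ⊆ L.baseSet (k a))
    (hVo : ∀ a, IsOpen (V a)) (hVc : ∀ x, ∃ a, x ∈ V a) {H : α → E → ℂ}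
    (hH : ∀ a, DifferentiableOn ℂ (H a) (cover Φ ⁻¹' V a))
    (hHper : ∀ a (n : ι → ℤ) (z : E), cover Φ z ∈ V a → H a (z + latticeVec Φ n) = H a z)
    (hHcob : ∀ a b (z : E), cover Φ z ∈ V a → cover Φ z ∈ V b →
      fderiv ℂ (fun y ↦ L.coordChange (k a) (k b) (cover Φ y)) z w / L.coordChange (k a) (k b) (cover Φ z) =
        H b z - H a z) :
    ∃ F : E → ℂ, Differentiable ℂ F ∧ ∀ (n : ι → ℤ) (z : E),
      fderiv ℂ (factorOfFrame L s n) z w / factorOfFrame L s n z = F z - F (z + latticeVec Φ n) := by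
  classical
  -- the candidate, read in the chosen refinement index
  let az : E → α := fun z ↦ Classical.choose (hVc (cover Φ z))
  have haz : ∀ z, cover Φ z ∈ V (az z) := fun z ↦ Classical.choose_spec (hVc (cover Φ z))
  let F : E → ℂ := fun z ↦ fderiv ℂ (s (k (az z))) z w / s (k (az z)) z - H (az z) z
  -- independence of the index
  have hF : ∀ (a : α) (z : E), cover Φ z ∈ V a → F z = fderiv ℂ (s (k a)) z w / s (k a) z - H a z := by
    intro a z ha
    have h1 := hs.fderiv_div_frame_eq (hVU _ (haz z)) (hVU _ ha) w
    have h2 := hHcob (az z) a z (haz z) ha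
    show fderiv ℂ (s (k (az z))) z w / s (k (az z)) z - H (az z) z = _
    rw [h1, h2]
    ring
  refine ⟨F, fun z ↦ ?_, fun n z ↦ ?_⟩
  · -- holomorphy: near `z`, `F = ∂_w s_{k a} / s_{k a} − H_a` for a fixed `a`
    obtain ⟨a, ha⟩ := hVc (cover Φ z)
    have hO : IsOpen (cover Φ ⁻¹' V a) := (hVo a).preimage (continuous_cover Φ)
    have hOU : IsOpen (cover Φ ⁻¹' L.baseSet (k a)) := (L.isOpen_baseSet (k a)).preimage (continuous_cover Φ)
    have hev : F =ᶠ[𝓝 z] fun y ↦ fderiv ℂ (s (k a)) y w / s (k a) y - H a y :=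
      Filter.eventually_of_mem (hO.mem_nhds ha) fun y hy ↦ hF a y hy
    refine (DifferentiableAt.congr_of_eventuallyEq ?_ hev)
    have hd1 : DifferentiableAt ℂ (fun y ↦ fderiv ℂ (s (k a)) y w) z :=
      (Literature.Analysis.Complex.SCV.differentiableOn_fderiv_apply (hs.differentiableOn (k a)) hOU w).differentiableAt
        (hOU.mem_nhds (hVU a ha))
    have hd2 : DifferentiableAt ℂ (fun y ↦ fderiv ℂ (s (k a)) y w / s (k a) y) z := by
      have heq : (fun y ↦ fderiv ℂ (s (k a)) y w / s (k a) y) = fun y ↦ fderiv ℂ (s (k a)) y w * (s (k a) y)⁻¹ := by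
        funext y; rw [div_eq_mul_inv]
      rw [heq]
      exact hd1.mul ((hs.differentiableAt (hVU a ha)).inv (hs.ne_zero (k a) z (hVU a ha)))
    exact hd2.sub ((hH a).differentiableAt (hO.mem_nhds ha))
  · obtain ⟨a, ha⟩ := hVc (cover Φ z)
    have ha' : cover Φ (z + latticeVec Φ n) ∈ V a := by rwa [cover_add_latticeVec]
    rw [hs.fderiv_div_factorOfFrame_eq (hVU a ha) n w, hF a z ha, hF a (z + latticeVec Φ n) ha', hHper a n z ha]
    ring

/-- **FRAME BOOKKEEPING (on the trivialising cover itself)**: if the logarithmic `w`-derivatives of the transition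
functions are coboundaries of Λ-PERIODIC holomorphic functions `H_k` on the cover pieces `π⁻¹U_k`
(`∂_w(g_{kl} ∘ π)/(g_{kl} ∘ π) = H_l − H_k`), then `F := ∂_w s_k/s_k − H_k` is independent of `k`, entire, and
`∂_w e(λ, ·)/e(λ, ·) = F − F(· + λ)` (the case `V_k = U_k` of the refinement form).
[cite: Lange2023AbelianVarietiesComplex, §1.2.1 Prop. 1.2.3 (p. 22)] [cite: MumfordAV1970, §13 (p. 125)] -/
theorem IsCoverFrame.exists_fderiv_div_factorOfFrame_eq_sub (hs : IsCoverFrame L s) (w : E) {H : κ → E → ℂ}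
    (hH : ∀ k, DifferentiableOn ℂ (H k) (cover Φ ⁻¹' L.baseSet k))
    (hHper : ∀ k (n : ι → ℤ) (z : E), cover Φ z ∈ L.baseSet k → H k (z + latticeVec Φ n) = H k z)
    (hHcob : ∀ k l (z : E), cover Φ z ∈ L.baseSet k → cover Φ z ∈ L.baseSet l →
      fderiv ℂ (fun y ↦ L.coordChange k l (cover Φ y)) z w / L.coordChange k l (cover Φ z) = H l z - H k z) :
    ∃ F : E → ℂ, Differentiable ℂ F ∧ ∀ (n : ι → ℤ) (z : E),
      fderiv ℂ (factorOfFrame L s n) z w / factorOfFrame L s n z = F z - F (z + latticeVec Φ n) :=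
  hs.exists_fderiv_div_factorOfFrame_eq_sub_of_refinement w (V := L.baseSet) (k := id) (fun _ ↦ subset_rfl)
    L.isOpen_baseSet L.exists_mem_baseSet hH hHper hHcob

end Frame

end ComplexTorus

end Literature.Geometry.Kaehler

end
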